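import Literature.AlgebraicGeometry.Deformation.MorphismLiftsSquareZeroCechPair
import Literature.AlgebraicGeometry.HodgeTheory.CoframeDerivationCoordinates
import HarnessLib
/-!
# The coordinate matrix of a pair of local lifts into a target with free `Ω¹`
# ([SGA1] III Prop. 5.1 «la classe dans `H¹(Y, 𝒢)`», coordinate form; [MFK94] Prop. 6.15 «`β ∈ H¹(X̄×X̄, μ̄^*𝒯 ⊗ I)`»)

Layer `Literature/AlgebraicGeometry/Deformation` (cell hodgecm-mathlib, (E) of [MFK94] Prop. 6.15, brick C4 §§0–4 of
`B-provers/B-p01/g16/SOCKETS-A4b-FileA-E.v0`).  THEOREMS ONLY.  Over ★ `MorphismLiftsSquareZeroCechPair` (the difference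
`δ` of two local lifts on an affine `W ⊆ U₁ ∩ U₂`), ★ `DerivationsKilledByIdeal` (C2: `J`-reduction `Δ` of `δ` and its
factorisation `Δ₀` through `Γ(X, V) ↠ Γ(X₀, G⁻¹V)`), ★ `SmallIdealFlatCoordinates` (C3) and ★
`HodgeTheory/CoframeDerivationCoordinates` (C1: coordinates of `Δ₀` in a coframe of `Ω¹_{X₀/S₀}`).

SETTING.  `A` local with maximal ideal `𝔪`, `J ≤ 𝔪` with `𝔪·J = 0` (so `J² = 0`) and generators `j₁ … j_r` independent
modulo `𝔪`; the target `p : X → Spec A` with its reduction `X₀ = X ×_A (A⧸J)` (`hG`) carrying a COFRAME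
`e : 𝒪^I ≅ Ω¹_{X₀/(A⧸J)}` (`I` finite) (★ `CotangentSheafFreeOverLocalRing` for abelian schemes); the source `q : Z → Spec A`
FLAT with its thickening `i : Z₀ → Z` (`hi`) and closed fibre `pr : Z̄ → Z` (`hpr`); affine opens `U₁, U₂ ⊇ W` of `Z`, local
`S`-lifts `g₁, g₂` of `f₀ : Z₀ → X` through `V₁, V₂`, a common affine target `V'`; `θ = pr♯ : Γ(Z, W) ↠ Γ(Z̄, W̄)` (kernel
`𝔪·Γ(Z, W)`).

* §1 `exists_reducedChart` — the chart `ψ₀ : Γ(X₀, G⁻¹V') → Γ(Z̄, W̄)` of the reduction, `ψ₀ ∘ G♯ = θ ∘ ψ₁` (any two agree);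
* §2 **`exists_coords_of_pair`** — THE COORDINATE MATRIX `cm : Fin r → I → Γ(Z̄, W̄)` of the pair: for every
  decomposition `ψ₂(a) − ψ₁(a) = ∑_ρ j_ρ d_ρ` one has `θ(d_ρ) = ∑_i ψ₀(λ_i(d(G♯a))) · cm ρ i`
  (`δ →[C2e] Δ →[C2a] Δ₀ →[C1] cm`);
* §3 **`matrix_ext`** (the matrix is determined by these identities, even tested only on restrictions of the sections of a
  bigger affine `V ⊇ V'`, ★ C1 `coords_ext_of_map`), **`matrix_add`** (three lifts: `cm₁₃ = cm₁₂ + cm₂₃`, the Čech cocycle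
  identity read on `Γ(Z̄, W̄)`), `matrix_eq_zero_of_eq` (equal lifts have matrix `0`);
* §4 **`matrix_restrict`** — the matrix of the restricted pair (`W' ⊆ W`, `V″ ⊆ V'`) is the restriction of the matrix.
The cover-level cocycles are assembled in ★ `MorphismLiftsSquareZeroCechCocycle`.

HC_CM is proved only modulo the 7 printed citations until rung 0 closes; this file discharges none of them.

## References
* [SGA1] A. Grothendieck, M. Raynaud, *SGA 1*, LNM 224 / arXiv:math/0206203: Exp. III §5 Prop. 5.1 (arXiv ed. p. 71).
* [MumfordFogartyKirwan1994] D. Mumford, J. Fogarty, F. Kirwan, *Geometric Invariant Theory*, 3rd ed. (1994), Ch. 6 §3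
  Prop. 6.15 (pp. 124–125).
* [Hartshorne2010] R. Hartshorne, *Deformation Theory*, GTM 257 (2010), §6 (pp. 45–50).
-/

noncomputable section

universe u

open CategoryTheory CategoryTheory.Limits AlgebraicGeometry Opposite IsLocalRing

namespace Literature.AlgebraicGeometry.Deformation

open Literature.AlgebraicGeometry.Modules Literature.AlgebraicGeometry.Motives Literature.AlgebraicGeometry.HodgeTheory
  Literature.AlgebraicGeometry.Morphisms
/-! ### §0 A generic chart fact -/

section Generic

variable {X Y : Scheme.{u}}

/-- `f.appLE U V` for `V = f⁻¹U` (propositionally) is `f.app U` up to transport: it is surjective with the same kernel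
whenever `f.app U` is surjective. [cite: Hartshorne2010, §6 proof of Thm. 6.4 (p. 50)] -/
theorem appLE_surjective_and_ker_eq_of_eq (f : X ⟶ Y) {U : Y.Opens} {V : X.Opens} (hV : V = f ⁻¹ᵁ U)
    (hs : Function.Surjective (f.app U)) :
    Function.Surjective (f.appLE U V hV.le) ∧ RingHom.ker (f.appLE U V hV.le).hom = RingHom.ker (f.app U).hom := by
  subst hV
  rw [← Scheme.Hom.app_eq_appLE]
  exact ⟨hs, rfl⟩

end Generic

/-! ### §1 The reduced chart `ψ₀ : Γ(X₀, G⁻¹V') → Γ(Z̄, W̄)` -/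

section ReducedChart

variable {A : Type u} [CommRing A] [IsLocalRing A] (J : Ideal A)
  {X : Scheme.{u}} {p : X ⟶ Spec (.of A)} {X₀ : Over (Spec (.of (A ⧸ J)))} {G : X₀.left ⟶ X}
  (hG : IsPullback G X₀.hom p (Spec.map (CommRingCat.ofHom (Ideal.Quotient.mk J))))
  {Z Zb : Scheme.{u}} {q : Z ⟶ Spec (.of A)} {qb : Zb ⟶ Spec (.of (ResidueField A))} {pr : Zb ⟶ Z}
  (hpr : IsPullback pr qb q (Spec.map (CommRingCat.ofHom (residue A))))

include hG hpr in
/-- **The chart of the reduction.**  For an affine `V' ⊆ X`, an affine `W ⊆ Z` with fibre `W̄ = pr⁻¹W`, and a ring map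
`ψ₁ : Γ(X, V') → Γ(Z, W)` intertwining the structure maps of `A` (the chart of an `S`-morphism), there is a ring map
`ψ₀ : Γ(X₀, G⁻¹V') → Γ(Z̄, W̄)` with `ψ₀ ∘ G♯ = pr♯ ∘ ψ₁`: `G♯` is onto with kernel `J·Γ(X, V')` (★ C2
`app_surjective_and_ker_eq_of_isPullback_mk`), which `pr♯ ∘ ψ₁` kills since `J ≤ 𝔪 = ker (A → k)`.
[cite: SGA1, Exp. III §5 Prop. 5.1] -/
theorem exists_reducedChart (hJle : J ≤ maximalIdeal A) {V' : X.Opens} (hV' : IsAffineOpen V') {W : Z.Opens}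
    (hW : IsAffineOpen W) {Wb : Zb.Opens} (hWb : Wb = pr ⁻¹ᵁ W) (ψ₁ : Γ(X, V') →+* Γ(Z, W))
    (hψ₁ : ∀ x : A, ψ₁ (X.presheaf.map (homOfLE (le_top : V' ≤ ⊤)).op (specStructureMap p x)) =
      Z.presheaf.map (homOfLE (le_top : W ≤ ⊤)).op (specStructureMap q x)) :
    ∃ ψ₀ : Γ(X₀.left, G ⁻¹ᵁ V') →+* Γ(Zb, Wb), ∀ a, ψ₀ (G.app V' a) = pr.appLE W Wb hWb.le (ψ₁ a) := by
  obtain ⟨hsurj, hker⟩ := app_surjective_and_ker_eq_of_isPullback_mk J hG ⟨V', hV'⟩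
  have hθ := appLE_surjective_and_ker_eq_of_eq pr hWb (app_surjective_and_ker_eq_of_isPullback_residue hpr ⟨W, hW⟩).1
  have hkerθ : RingHom.ker (pr.appLE W Wb hWb.le).hom =
      (maximalIdeal A).map ((Z.presheaf.map (homOfLE (le_top : W ≤ ⊤)).op).hom.comp (specStructureMap q)) := by
    rw [hθ.2]; exact (app_surjective_and_ker_eq_of_isPullback_residue hpr ⟨W, hW⟩).2
  have hle : RingHom.ker (G.app V').hom ≤ RingHom.ker ((pr.appLE W Wb hWb.le).hom.comp ψ₁) := by
    rw [hker, Ideal.map_le_iff_le_comap]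
    intro x hx
    rw [Ideal.mem_comap, RingHom.mem_ker, RingHom.comp_apply, RingHom.comp_apply, hψ₁]
    have hx' : Z.presheaf.map (homOfLE (le_top : W ≤ ⊤)).op (specStructureMap q x) ∈
        RingHom.ker (pr.appLE W Wb hWb.le).hom := by
      rw [hkerθ]
      exact Ideal.mem_map_of_mem _ (hJle hx)
    exact hx'
  refine ⟨(G.app V').hom.liftOfSurjective hsurj ⟨(pr.appLE W Wb hWb.le).hom.comp ψ₁, hle⟩, fun a => ?_⟩
  exact (G.app V').hom.liftOfRightInverse_comp_apply _ _ _ a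

omit [IsLocalRing A] in
/-- Any two reduced charts agree (`G♯` is onto). [cite: Hartshorne2010, §6 proof of Thm. 6.4 (p. 50)] -/
theorem reducedChart_unique {V' : X.Opens} (hsurj : Function.Surjective (G.app V')) {C : Type*} [CommRing C]
    {t : Γ(X, V') → C} {ψ₀ ψ₀' : Γ(X₀.left, G ⁻¹ᵁ V') →+* C} (h : ∀ a, ψ₀ (G.app V' a) = t a)
    (h' : ∀ a, ψ₀' (G.app V' a) = t a) : ψ₀ = ψ₀' := by
  refine RingHom.ext fun x => ?_
  obtain ⟨a, rfl⟩ := hsurj x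
  rw [h, h']

end ReducedChart

/-! ### §2 The coordinate matrix of a pair of local lifts -/

section Coords

variable {A : Type u} [CommRing A] [IsLocalRing A] (J : Ideal A) {r : ℕ} (j : Fin r → A)
  {X : Scheme.{u}} (p : X ⟶ Spec (.of A)) {X₀ : Over (Spec (.of (A ⧸ J)))} {G : X₀.left ⟶ X}
  (hG : IsPullback G X₀.hom p (Spec.map (CommRingCat.ofHom (Ideal.Quotient.mk J))))
  {I : Type u} [Fintype I] (e : SheafOfModules.free I ≅ (cotangentSheaf X₀).over ⊤)
  {Z Z₀ Zb : Scheme.{u}} (q : Z ⟶ Spec (.of A)) {q₀ : Z₀ ⟶ Spec (.of (A ⧸ J))} {i : Z₀ ⟶ Z}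
  (hi : IsPullback i q₀ q (Spec.map (CommRingCat.ofHom (Ideal.Quotient.mk J))))
  {qb : Zb ⟶ Spec (.of (ResidueField A))} {pr : Zb ⟶ Z}
  (hpr : IsPullback pr qb q (Spec.map (CommRingCat.ofHom (residue A))))
  (f₀ : Z₀ ⟶ X)
  {U₁ U₂ W : Z.Opens} (hU₁ : IsAffineOpen U₁) (hU₂ : IsAffineOpen U₂) (hW : IsAffineOpen W)
  (hW₁ : W ≤ U₁) (hW₂ : W ≤ U₂) {Wb : Zb.Opens} (hWb : Wb = pr ⁻¹ᵁ W)
  {V' : X.Opens} (hV' : IsAffineOpen V')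
  (g₁ : Spec (.of Γ(Z, U₁)) ⟶ X) (g₂ : Spec (.of Γ(Z, U₂)) ⟶ X)

/-- `J² = 0` from `𝔪·J = 0` and `J ≤ 𝔪`. [cite: Hartshorne2010, §6 (6.1) p. 46] -/
theorem mul_self_eq_bot_of_le_maximalIdeal (hmJ : maximalIdeal A * J = ⊥) (hJle : J ≤ maximalIdeal A) : J * J = ⊥ :=
  le_bot_iff.mp (hmJ ▸ Ideal.mul_mono_left hJle)

omit [IsLocalRing A] in
/-- The constants of `X₀`: `(constToPresheaf X₀)(s)` over `V₀` is the restriction of `specStructureMap X₀.hom s`. [cite: StacksProject, Tag 01ED (Cohomology, Section 20.9)] -/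
theorem constToPresheaf_app_eq (V₀ : X₀.left.Opens) (s : A ⧸ J) :
    (constToPresheaf X₀).app (op V₀) s = X₀.left.presheaf.map (homOfLE (le_top : V₀ ≤ ⊤)).op (specStructureMap X₀.hom s) :=
  rfl

omit [IsLocalRing A] in
include hW in
/-- The sections of the FLAT `A`-scheme `Z` over an affine open form a flat `A`-algebra for the structure map
`res ∘ specStructureMap q` (Mathlib: `Flat` is the `HasRingHomProperty` of `RingHom.Flat`, read on `⊤ ⊆ Spec A`, `W ⊆ Z`).
[cite: Hartshorne2010, §6 (6.1) p. 46 («`X'` flat over `C'`»)] -/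
theorem moduleFlat_sections_of_flat [Flat q] :
    letI : Algebra A Γ(Z, W) := ((Z.presheaf.map (homOfLE (le_top : W ≤ ⊤)).op).hom.comp (specStructureMap q)).toAlgebra
    Module.Flat A Γ(Z, W) := by
  have h1 : (q.appLE ⊤ W le_top).hom.Flat :=
    HasRingHomProperty.appLE @Flat q inferInstance ⟨⊤, isAffineOpen_top _⟩ ⟨W, hW⟩ le_top
  have h2 : ((q.appLE ⊤ W le_top).hom.comp (Scheme.ΓSpecIso (.of A)).inv.hom).Flat :=
    RingHom.Flat.comp (RingHom.Flat.of_bijective (Scheme.ΓSpecIso (.of A)).symm.commRingCatIsoToRingEquiv.bijective) h1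
  exact h2

include hG hi hpr hW hV' in
/-- **The coordinate matrix of a pair of local lifts** ([SGA1] III 5.1, the component `c_{12} ∈ 𝒢(U₁ ∩ U₂)` of the
obstruction cocycle, in coordinates; [MFK94] Prop. 6.15 «`β ∈ H¹(X̄ × X̄, μ̄^*𝒯 ⊗ I)`» with `𝒯 ≅ 𝒪 ⊗ Lie`).  In the
SETTING of the file header, for the two restricted lifts on the affine `W ⊆ U₁ ∩ U₂` read in the common affine target
`V'` with charts `ψ₁, ψ₂`: there is a matrix `cm : Fin r → I → Γ(Z̄, W̄)` such that for every reduced chart `ψ₀`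
(`ψ₀ ∘ G♯ = pr♯ ∘ ψ₁`) and every decomposition `ψ₂(a) − ψ₁(a) = ∑_ρ j_ρ · d_ρ` (`d_ρ ∈ Γ(Z, W)`; they exist since the
difference takes values in `J·Γ(Z, W)`) one has `pr♯(d_ρ) = ∑_t ψ₀(λ_t(d(G♯ a))) · cm ρ t`, `λ_t` the coordinates in the
coframe `e`.  Proof: `δ = ψ₂ − ψ₁` (★ `difference_leibniz_and_mem_ker`) →[★ C2e `exists_jReduction`, flatness of `Γ(Z, W)`]
`Δ : Γ(X, V') → Γ(Z̄, W̄)^r` →[★ C2a `exists_leibniz_factor_of_surjective` through `G♯`, kernel `J·Γ(X, V')`] `Δ₀` →[★ C1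
`exists_coords_of_leibniz` on `X₀`] `cm`. [cite: SGA1, Exp. III §5 Prop. 5.1]
[cite: MumfordFogartyKirwan1994, Ch. 6 §3 Prop. 6.15 (pp. 124–125)] -/
theorem exists_coords_of_pair [Flat q] (hj : ∀ ρ, j ρ ∈ J) (hspan : J ≤ Ideal.span (Set.range j))
    (hind : ∀ a : Fin r → A, ∑ ρ, a ρ * j ρ = 0 → ∀ ρ, a ρ ∈ maximalIdeal A)
    (hmJ : maximalIdeal A * J = ⊥) (hJle : J ≤ maximalIdeal A)
    (w₁ : g₁ ≫ p = hU₁.fromSpec ≫ q) (w₂ : g₂ ≫ p = hU₂.fromSpec ≫ q)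
    (h₁ : Spec.map (i.app U₁) ≫ g₁ = (isAffineOpen_preimage_of_isPullback_mk J hi ⟨U₁, hU₁⟩).fromSpec ≫ f₀)
    (h₂ : Spec.map (i.app U₂) ≫ g₂ = (isAffineOpen_preimage_of_isPullback_mk J hi ⟨U₂, hU₂⟩).fromSpec ≫ f₀)
    (h₁' : (Spec.map (Z.presheaf.map (homOfLE hW₁).op) ≫ g₁) ⁻¹ᵁ V' = ⊤)
    (h₂' : (Spec.map (Z.presheaf.map (homOfLE hW₂).op) ≫ g₂) ⁻¹ᵁ V' = ⊤)
    (ψ₁ ψ₂ : Γ(X, V') ⟶ CommRingCat.of Γ(Z, W))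
    (hψ₁ : ψ₁ = (Spec.map (Z.presheaf.map (homOfLE hW₁).op) ≫ g₁).appLE V' ⊤ h₁'.ge ≫
      (Scheme.ΓSpecIso (.of Γ(Z, W))).hom)
    (hψ₂ : ψ₂ = (Spec.map (Z.presheaf.map (homOfLE hW₂).op) ≫ g₂).appLE V' ⊤ h₂'.ge ≫
      (Scheme.ΓSpecIso (.of Γ(Z, W))).hom) :
    ∃ cm : Fin r → I → Γ(Zb, Wb),
      ∀ (ψ₀ : Γ(X₀.left, G ⁻¹ᵁ V') →+* Γ(Zb, Wb)), (∀ a, ψ₀ (G.app V' a) = pr.appLE W Wb hWb.le (ψ₁ a)) →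
      ∀ (a : Γ(X, V')) (d : Fin r → Γ(Z, W)),
        ψ₂ a - ψ₁ a = ∑ ρ, Z.presheaf.map (homOfLE (le_top : W ≤ ⊤)).op (specStructureMap q (j ρ)) * d ρ →
        ∀ ρ, pr.appLE W Wb hWb.le (d ρ) =
          ∑ t, ψ₀ (coord e (homOfLE le_top) (dSection X₀ (G ⁻¹ᵁ V') (G.app V' a)) t) * cm ρ t := by
  classical
  have hJ2 := mul_self_eq_bot_of_le_maximalIdeal J hmJ hJle
  obtain ⟨hleib, hs₁, hs₂, hker⟩ := difference_leibniz_and_mem_ker J p q hi f₀ hU₁ hU₂ hW hW₁ hW₂ g₁ g₂ hJ2 hV' w₁ w₂ h₁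
    h₂ h₁' h₂' ψ₁ ψ₂ hψ₁ hψ₂
  -- scalar structures
  set sZ : A →+* Γ(Z, W) := ((Z.presheaf.map (homOfLE (le_top : W ≤ ⊤)).op).hom.comp (specStructureMap q)) with hsZ
  set sX : A →+* Γ(X, V') := ((X.presheaf.map (homOfLE (le_top : V' ≤ ⊤)).op).hom.comp (specStructureMap p)) with hsX
  letI algZ : Algebra A Γ(Z, W) := sZ.toAlgebra
  have halg : ∀ x, algebraMap A Γ(Z, W) x = sZ x := fun _ => rfl
  haveI : Module.Flat A Γ(Z, W) := moduleFlat_sections_of_flat q hW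
  -- `θ = pr♯ : Γ(Z, W) → Γ(Z̄, W̄)`, onto with kernel `𝔪·Γ(Z, W)`
  obtain ⟨hθs, hθk⟩ := appLE_surjective_and_ker_eq_of_eq pr hWb (app_surjective_and_ker_eq_of_isPullback_residue hpr ⟨W, hW⟩).1
  set θ : Γ(Z, W) →+* Γ(Zb, Wb) := (pr.appLE W Wb hWb.le).hom with hθ
  have hkerθ : RingHom.ker θ = (maximalIdeal A).map (algebraMap A Γ(Z, W)) := by
    rw [hθ, hθk]; exact (app_surjective_and_ker_eq_of_isPullback_residue hpr ⟨W, hW⟩).2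
  -- `δ = ψ₂ − ψ₁` in C2e's dialect
  set δ : Γ(X, V') → Γ(Z, W) := fun a => ψ₂ a - ψ₁ a with hδdef
  have hadd : ∀ a b, δ (a + b) = δ a + δ b := fun a b => by
    simp only [hδdef, map_add]; abel
  have hmul : ∀ a b, δ (a * b) = ψ₁.hom a * δ b + ψ₁.hom b * δ a := fun a b => hleib a b
  have hψ : ∀ x, ψ₁.hom (sX x) = algebraMap A Γ(Z, W) x := fun x => hs₁ x
  have hconst : ∀ x, δ (sX x) = 0 := fun x => by
    change ψ₂ (sX x) - ψ₁ (sX x) = 0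
    rw [show ψ₂ (sX x) = sZ x from hs₂ x, show ψ₁ (sX x) = sZ x from hs₁ x, sub_self]
  have hkerJ := (app_surjective_and_ker_eq_of_isPullback_mk J hi ⟨W, hW⟩).2
  have hδJ : ∀ a, δ a ∈ J.map (algebraMap A Γ(Z, W)) := fun a => by
    have h := hker a
    rw [hkerJ] at h
    exact h
  obtain ⟨Δ, hΔadd, hΔmul, hΔconst, hΔchar, -, hΔJ⟩ :=
    exists_jReduction j hj hspan hind hmJ hJle θ hkerθ sX ψ₁.hom hψ δ hadd hmul hconst hδJ
  -- factor through `G♯ : Γ(X, V') ↠ Γ(X₀, G⁻¹V')` (kernel `J·Γ(X, V')`)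
  obtain ⟨hsurjG, hkerG⟩ := app_surjective_and_ker_eq_of_isPullback_mk J hG ⟨V', hV'⟩
  obtain ⟨ψ₀', hψ₀'⟩ := exists_reducedChart J hG hpr hJle hV' hW hWb ψ₁.hom hs₁
  have hfac : ∀ a, (θ.comp ψ₁.hom) a = ψ₀' ((G.app V').hom a) := fun a => (hψ₀' a).symm
  have hΔmul' : ∀ a b, Δ (a * b) = (θ.comp ψ₁.hom) a • Δ b + (θ.comp ψ₁.hom) b • Δ a := fun a b => hΔmul a b
  have hkerΔ : ∀ a ∈ RingHom.ker (G.app V').hom, Δ a = 0 := fun a ha => by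
    rw [hkerG] at ha
    exact hΔJ a ha
  obtain ⟨Δ₀, hΔ₀, hΔ₀add, hΔ₀mul⟩ :=
    exists_leibniz_factor_of_surjective (G.app V').hom hsurjG (θ.comp ψ₁.hom) ψ₀' hfac Δ hΔadd hΔmul' hkerΔ
  -- constants downstairs
  have hcomm : ∀ x, (G.app V').hom (sX x) =
      ((X₀.left.presheaf.map (homOfLE (le_top : G ⁻¹ᵁ V' ≤ ⊤)).op).hom.comp (specStructureMap X₀.hom))
        (Ideal.Quotient.mk J x) := fun x => app_specStructureMap_of_isPullback_mk J hG V' x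
  have hconst₀ : ∀ s : A ⧸ J, Δ₀ ((constToPresheaf X₀).app (op (G ⁻¹ᵁ V')) s) = 0 := fun s => by
    rw [constToPresheaf_app_eq]
    exact leibniz_factor_const_eq_zero (G.app V').hom sX
      ((X₀.left.presheaf.map (homOfLE (le_top : G ⁻¹ᵁ V' ≤ ⊤)).op).hom.comp (specStructureMap X₀.hom))
      (Ideal.Quotient.mk J) Ideal.Quotient.mk_surjective hcomm hΔ₀ hΔconst s
  -- coordinates in the coframe (C1)
  have hV₀ : IsAffineOpen (G ⁻¹ᵁ V') := isAffineOpen_preimage_of_isPullback_mk J hG ⟨V', hV'⟩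
  obtain ⟨c, hc⟩ := exists_coords_of_leibniz e hV₀ (homOfLE le_top) ψ₀' Δ₀ hΔ₀add hΔ₀mul hconst₀
  refine ⟨fun ρ t => c t ρ, fun ψ₀ hψ₀ a d hd ρ => ?_⟩
  have hψeq : ψ₀ = ψ₀' := reducedChart_unique (J := J) hsurjG hψ₀ hψ₀'
  subst hψeq
  have hd' : δ a = ∑ ρ, algebraMap A Γ(Z, W) (j ρ) * d ρ := hd
  rw [show pr.appLE W Wb hWb.le (d ρ) = θ (d ρ) from rfl, ← hΔchar a d hd' ρ, hΔ₀ a, hc]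
  simp only [Finset.sum_apply, Pi.smul_apply, smul_eq_mul]

end Coords

/-! ### §3 The matrix is determined by its characteristic identities; additivity and vanishing -/

section MatrixExt

variable {A : Type u} [CommRing A] [IsLocalRing A] (J : Ideal A) {r : ℕ} (j : Fin r → A)
  {X : Scheme.{u}} (p : X ⟶ Spec (.of A)) {X₀ : Over (Spec (.of (A ⧸ J)))} {G : X₀.left ⟶ X}
  (hG : IsPullback G X₀.hom p (Spec.map (CommRingCat.ofHom (Ideal.Quotient.mk J))))
  {I : Type u} [Fintype I] (e : SheafOfModules.free I ≅ (cotangentSheaf X₀).over ⊤)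
  {Z Zb : Scheme.{u}} (q : Z ⟶ Spec (.of A)) {qb : Zb ⟶ Spec (.of (ResidueField A))} {pr : Zb ⟶ Z}
  (hpr : IsPullback pr qb q (Spec.map (CommRingCat.ofHom (residue A))))

omit [IsLocalRing A] in
include hG in
/-- **CORE: a matrix is determined by its pairing against the coordinates of the exact forms `d(G♯ a)`, even tested only on
the restrictions `a|_{V″}` of the sections of a bigger affine `V' ⊇ V″`** (★ C1 `coords_ext_of_map` on `X₀` + `G♯` onto,
★ C2 `app_surjective_and_ker_eq_of_isPullback_mk`). [cite: SGA1, Exp. III §5 Prop. 5.1] -/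
theorem matrix_ext_of_map {V' V'' : X.Opens} (hV' : IsAffineOpen V') (l : V'' ≤ V') {Cb : Type*} [CommRing Cb]
    (ψ₀ : Γ(X₀.left, G ⁻¹ᵁ V'') →+* Cb) {cm cm' : Fin r → I → Cb}
    (h : ∀ (a : Γ(X, V')) (ρ : Fin r),
      ∑ t, ψ₀ (coord e (homOfLE le_top) (dSection X₀ (G ⁻¹ᵁ V'') (G.app V'' (X.presheaf.map (homOfLE l).op a))) t) *
          cm ρ t =
        ∑ t, ψ₀ (coord e (homOfLE le_top) (dSection X₀ (G ⁻¹ᵁ V'') (G.app V'' (X.presheaf.map (homOfLE l).op a))) t) *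
          cm' ρ t) :
    cm = cm' := by
  funext ρ
  have hV₀ : IsAffineOpen (G ⁻¹ᵁ V') := isAffineOpen_preimage_of_isPullback_mk J hG ⟨V', hV'⟩
  obtain ⟨hsurj, -⟩ := app_surjective_and_ker_eq_of_isPullback_mk J hG ⟨V', hV'⟩
  refine coords_ext_of_map e hV₀ (homOfLE (le_top : G ⁻¹ᵁ V' ≤ ⊤)) (homOfLE (G.preimage_mono l)) ψ₀ fun x => ?_
  obtain ⟨a, rfl⟩ := hsurj x
  have hnat' : X.presheaf.map (homOfLE l).op ≫ G.app V'' =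
      G.app V' ≫ X₀.left.presheaf.map (homOfLE (G.preimage_mono l)).op := G.naturality (homOfLE l).op
  have hnat : X₀.left.presheaf.map (homOfLE (G.preimage_mono l)).op (G.app V' a) =
      G.app V'' (X.presheaf.map (homOfLE l).op a) := by
    have h := congrArg (fun φ => φ.hom a) hnat'
    simpa only [CommRingCat.hom_comp, RingHom.comp_apply] using h.symm
  have hk : (homOfLE (G.preimage_mono l) ≫ homOfLE (le_top : G ⁻¹ᵁ V' ≤ ⊤)) = homOfLE (le_top : G ⁻¹ᵁ V'' ≤ ⊤) :=
    Subsingleton.elim _ _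
  simp only [hnat, hk, smul_eq_mul]
  exact h a ρ

omit [IsLocalRing A] in
include hG in
/-- CORE, same-open form (`V″ = V'`). [cite: SGA1, Exp. III §5 Prop. 5.1] -/
theorem matrix_ext {V' : X.Opens} (hV' : IsAffineOpen V') {Cb : Type*} [CommRing Cb]
    (ψ₀ : Γ(X₀.left, G ⁻¹ᵁ V') →+* Cb) {cm cm' : Fin r → I → Cb}
    (h : ∀ (a : Γ(X, V')) (ρ : Fin r),
      ∑ t, ψ₀ (coord e (homOfLE le_top) (dSection X₀ (G ⁻¹ᵁ V') (G.app V' a)) t) * cm ρ t =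
        ∑ t, ψ₀ (coord e (homOfLE le_top) (dSection X₀ (G ⁻¹ᵁ V') (G.app V' a)) t) * cm' ρ t) :
    cm = cm' := by
  funext ρ
  have hV₀ : IsAffineOpen (G ⁻¹ᵁ V') := isAffineOpen_preimage_of_isPullback_mk J hG ⟨V', hV'⟩
  obtain ⟨hsurj, -⟩ := app_surjective_and_ker_eq_of_isPullback_mk J hG ⟨V', hV'⟩
  refine coords_ext e hV₀ (homOfLE (le_top : G ⁻¹ᵁ V' ≤ ⊤)) ψ₀ fun x => ?_
  obtain ⟨a, rfl⟩ := hsurj x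
  simp only [smul_eq_mul]
  exact h a ρ

include hG hpr in
/-- **ADDITIVITY of the matrices of three charts** (`δ₁₃ = δ₁₂ + δ₂₃`: the Čech cocycle identity, before restriction).
For ring maps `ψ₁, ψ₂, ψ₃ : Γ(X, V') → Γ(Z, W)` intertwining the structure maps, with pairwise differences in `J·Γ(Z, W)`,
and matrices `cm₁₂, cm₂₃, cm₁₃` satisfying the characteristic identities of ★ `exists_coords_of_pair` for the pairs
`(ψ₁,ψ₂)`, `(ψ₂,ψ₃)`, `(ψ₁,ψ₃)`: `cm₁₃ = cm₁₂ + cm₂₃`. [cite: SGA1, Exp. III §5 Prop. 5.1]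
[cite: MumfordFogartyKirwan1994, Ch. 6 §3 Prop. 6.15 (pp. 124–125)] -/
theorem matrix_add (hspan : J ≤ Ideal.span (Set.range j)) (hJle : J ≤ maximalIdeal A)
    {V' : X.Opens} (hV' : IsAffineOpen V') {W : Z.Opens} (hW : IsAffineOpen W) {Wb : Zb.Opens} (hWb : Wb = pr ⁻¹ᵁ W)
    (ψ₁ ψ₂ ψ₃ : Γ(X, V') →+* Γ(Z, W))
    (hs₁ : ∀ x : A, ψ₁ (X.presheaf.map (homOfLE (le_top : V' ≤ ⊤)).op (specStructureMap p x)) =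
      Z.presheaf.map (homOfLE (le_top : W ≤ ⊤)).op (specStructureMap q x))
    (hδ₁₂ : ∀ a, ψ₂ a - ψ₁ a ∈ J.map ((Z.presheaf.map (homOfLE (le_top : W ≤ ⊤)).op).hom.comp (specStructureMap q)))
    (hδ₂₃ : ∀ a, ψ₃ a - ψ₂ a ∈ J.map ((Z.presheaf.map (homOfLE (le_top : W ≤ ⊤)).op).hom.comp (specStructureMap q)))
    {cm₁₂ cm₂₃ cm₁₃ : Fin r → I → Γ(Zb, Wb)}
    (h₁₂ : ∀ (ψ₀ : Γ(X₀.left, G ⁻¹ᵁ V') →+* Γ(Zb, Wb)), (∀ a, ψ₀ (G.app V' a) = pr.appLE W Wb hWb.le (ψ₁ a)) →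
      ∀ (a : Γ(X, V')) (d : Fin r → Γ(Z, W)),
        ψ₂ a - ψ₁ a = ∑ ρ, Z.presheaf.map (homOfLE (le_top : W ≤ ⊤)).op (specStructureMap q (j ρ)) * d ρ →
        ∀ ρ, pr.appLE W Wb hWb.le (d ρ) =
          ∑ t, ψ₀ (coord e (homOfLE le_top) (dSection X₀ (G ⁻¹ᵁ V') (G.app V' a)) t) * cm₁₂ ρ t)
    (h₂₃ : ∀ (ψ₀ : Γ(X₀.left, G ⁻¹ᵁ V') →+* Γ(Zb, Wb)), (∀ a, ψ₀ (G.app V' a) = pr.appLE W Wb hWb.le (ψ₂ a)) →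
      ∀ (a : Γ(X, V')) (d : Fin r → Γ(Z, W)),
        ψ₃ a - ψ₂ a = ∑ ρ, Z.presheaf.map (homOfLE (le_top : W ≤ ⊤)).op (specStructureMap q (j ρ)) * d ρ →
        ∀ ρ, pr.appLE W Wb hWb.le (d ρ) =
          ∑ t, ψ₀ (coord e (homOfLE le_top) (dSection X₀ (G ⁻¹ᵁ V') (G.app V' a)) t) * cm₂₃ ρ t)
    (h₁₃ : ∀ (ψ₀ : Γ(X₀.left, G ⁻¹ᵁ V') →+* Γ(Zb, Wb)), (∀ a, ψ₀ (G.app V' a) = pr.appLE W Wb hWb.le (ψ₁ a)) →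
      ∀ (a : Γ(X, V')) (d : Fin r → Γ(Z, W)),
        ψ₃ a - ψ₁ a = ∑ ρ, Z.presheaf.map (homOfLE (le_top : W ≤ ⊤)).op (specStructureMap q (j ρ)) * d ρ →
        ∀ ρ, pr.appLE W Wb hWb.le (d ρ) =
          ∑ t, ψ₀ (coord e (homOfLE le_top) (dSection X₀ (G ⁻¹ᵁ V') (G.app V' a)) t) * cm₁₃ ρ t) :
    cm₁₃ = cm₁₂ + cm₂₃ := by
  classical
  letI algZ : Algebra A Γ(Z, W) :=
    ((Z.presheaf.map (homOfLE (le_top : W ≤ ⊤)).op).hom.comp (specStructureMap q)).toAlgebra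
  obtain ⟨ψ₀, hψ₀⟩ := exists_reducedChart J hG hpr hJle hV' hW hWb ψ₁ hs₁
  -- `θ ∘ ψ₂ = θ ∘ ψ₁` since `ψ₂ − ψ₁ ∈ J·Γ(Z, W) ⊆ 𝔪·Γ(Z, W) = ker θ`
  obtain ⟨-, hθk⟩ := appLE_surjective_and_ker_eq_of_eq pr hWb (app_surjective_and_ker_eq_of_isPullback_residue hpr ⟨W, hW⟩).1
  have hkerθ : RingHom.ker (pr.appLE W Wb hWb.le).hom =
      (maximalIdeal A).map ((Z.presheaf.map (homOfLE (le_top : W ≤ ⊤)).op).hom.comp (specStructureMap q)) := by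
    rw [hθk]; exact (app_surjective_and_ker_eq_of_isPullback_residue hpr ⟨W, hW⟩).2
  have hψ₀₂ : ∀ a, ψ₀ (G.app V' a) = pr.appLE W Wb hWb.le (ψ₂ a) := fun a => by
    have hmem : ψ₂ a - ψ₁ a ∈ RingHom.ker (pr.appLE W Wb hWb.le).hom := by
      rw [hkerθ]; exact Ideal.map_mono hJle (hδ₁₂ a)
    rw [RingHom.mem_ker, map_sub, sub_eq_zero] at hmem
    rw [hψ₀ a]
    exact hmem.symm
  refine matrix_ext J p hG e hV' ψ₀ fun a ρ => ?_
  obtain ⟨d₁₂, hd₁₂⟩ := exists_eq_sum_mul_of_mem_map (C := Γ(Z, W)) j hspan (hδ₁₂ a)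
  obtain ⟨d₂₃, hd₂₃⟩ := exists_eq_sum_mul_of_mem_map (C := Γ(Z, W)) j hspan (hδ₂₃ a)
  have hd₁₃ : ψ₃ a - ψ₁ a =
      ∑ ρ, Z.presheaf.map (homOfLE (le_top : W ≤ ⊤)).op (specStructureMap q (j ρ)) * (d₁₂ ρ + d₂₃ ρ) := by
    have : ψ₃ a - ψ₁ a = (ψ₂ a - ψ₁ a) + (ψ₃ a - ψ₂ a) := by abel
    rw [this, hd₁₂, hd₂₃, ← Finset.sum_add_distrib]
    exact Finset.sum_congr rfl fun ρ _ => by rw [mul_add]; rfl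
  have e₁₃ := h₁₃ ψ₀ hψ₀ a (fun ρ => d₁₂ ρ + d₂₃ ρ) hd₁₃ ρ
  have e₁₂ := h₁₂ ψ₀ hψ₀ a d₁₂ hd₁₂ ρ
  have e₂₃ := h₂₃ ψ₀ hψ₀₂ a d₂₃ hd₂₃ ρ
  rw [map_add, e₁₂, e₂₃, ← Finset.sum_add_distrib] at e₁₃
  rw [← e₁₃]
  exact Finset.sum_congr rfl fun t _ => by rw [Pi.add_apply, Pi.add_apply, mul_add]

include hG hpr in
/-- **VANISHING: the matrix of a pair with EQUAL charts is zero** (the decomposition `d = 0` of `ψ₁ − ψ₁ = 0`).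
[cite: SGA1, Exp. III §5 Prop. 5.1] -/
theorem matrix_eq_zero_of_eq (hJle : J ≤ maximalIdeal A) {V' : X.Opens} (hV' : IsAffineOpen V') {W : Z.Opens}
    (hW : IsAffineOpen W) {Wb : Zb.Opens} (hWb : Wb = pr ⁻¹ᵁ W) (ψ₁ : Γ(X, V') →+* Γ(Z, W))
    (hs₁ : ∀ x : A, ψ₁ (X.presheaf.map (homOfLE (le_top : V' ≤ ⊤)).op (specStructureMap p x)) =
      Z.presheaf.map (homOfLE (le_top : W ≤ ⊤)).op (specStructureMap q x))
    {cm : Fin r → I → Γ(Zb, Wb)}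
    (h : ∀ (ψ₀ : Γ(X₀.left, G ⁻¹ᵁ V') →+* Γ(Zb, Wb)), (∀ a, ψ₀ (G.app V' a) = pr.appLE W Wb hWb.le (ψ₁ a)) →
      ∀ (a : Γ(X, V')) (d : Fin r → Γ(Z, W)),
        ψ₁ a - ψ₁ a = ∑ ρ, Z.presheaf.map (homOfLE (le_top : W ≤ ⊤)).op (specStructureMap q (j ρ)) * d ρ →
        ∀ ρ, pr.appLE W Wb hWb.le (d ρ) =
          ∑ t, ψ₀ (coord e (homOfLE le_top) (dSection X₀ (G ⁻¹ᵁ V') (G.app V' a)) t) * cm ρ t) :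
    cm = 0 := by
  obtain ⟨ψ₀, hψ₀⟩ := exists_reducedChart J hG hpr hJle hV' hW hWb ψ₁ hs₁
  refine matrix_ext J p hG e hV' ψ₀ fun a ρ => ?_
  have h0 := h ψ₀ hψ₀ a (fun _ => 0) (by simp) ρ
  rw [map_zero] at h0
  rw [← h0]
  simp

end MatrixExt

/-! ### §4 Restriction of the matrix to a smaller source open and a smaller target open -/

section MatrixRestrict

variable {A : Type u} [CommRing A] [IsLocalRing A] (J : Ideal A) {r : ℕ} (j : Fin r → A)
  {X : Scheme.{u}} (p : X ⟶ Spec (.of A)) {X₀ : Over (Spec (.of (A ⧸ J)))} {G : X₀.left ⟶ X}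
  (hG : IsPullback G X₀.hom p (Spec.map (CommRingCat.ofHom (Ideal.Quotient.mk J))))
  {I : Type u} [Fintype I] (e : SheafOfModules.free I ≅ (cotangentSheaf X₀).over ⊤)
  {Z Zb : Scheme.{u}} (q : Z ⟶ Spec (.of A)) {qb : Zb ⟶ Spec (.of (ResidueField A))} {pr : Zb ⟶ Z}
  (hpr : IsPullback pr qb q (Spec.map (CommRingCat.ofHom (residue A))))

/-- Naturality of `pr♯` with the restrictions: `pr♯_{W'}(x|_{W'}) = pr♯_W(x)|_{W̄'}`. [cite: StacksProject, Tag 01ED (Cohomology, Section 20.9)] -/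
theorem appLE_map_apply_of_le {W W' : Z.Opens} (hWW' : W' ≤ W) {Wb Wb' : Zb.Opens} (hWb : Wb = pr ⁻¹ᵁ W)
    (hWb' : Wb' = pr ⁻¹ᵁ W') (hb : Wb' ≤ Wb) (x : Γ(Z, W)) :
    pr.appLE W' Wb' hWb'.le (Z.presheaf.map (homOfLE hWW').op x) =
      Zb.presheaf.map (homOfLE hb).op (pr.appLE W Wb hWb.le x) := by
  have h1 : Z.presheaf.map (homOfLE hWW').op ≫ pr.appLE W' Wb' hWb'.le =
      pr.appLE W Wb' (hb.trans hWb.le) := Scheme.Hom.map_appLE _ _ _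
  have h2 : pr.appLE W Wb hWb.le ≫ Zb.presheaf.map (homOfLE hb).op = pr.appLE W Wb' (hb.trans hWb.le) :=
    Scheme.Hom.appLE_map _ _ _
  rw [← CommRingCat.comp_apply, h1, ← h2, CommRingCat.comp_apply]

include hG hpr in
/-- **RESTRICTION of the matrix** (the component of the cocycle restricts with the structure sheaf): if the charts
`ψₖ' : Γ(X, V″) → Γ(Z, W')` of the pair read on smaller affine opens `W' ⊆ W`, `V″ ⊆ V'` are the restrictions of
`ψₖ : Γ(X, V') → Γ(Z, W)` (`ψₖ'(a|_{V″}) = ψₖ(a)|_{W'}`), then the matrix of `(ψ₁', ψ₂')` is the restriction to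
`Γ(Z̄, W̄')` of the matrix of `(ψ₁, ψ₂)` (★ C1 naturality of coordinates `coords_ext_of_map` ∕ `coord_dSection_map`).
[cite: SGA1, Exp. III §5 Prop. 5.1] -/
theorem matrix_restrict (hspan : J ≤ Ideal.span (Set.range j)) (hJle : J ≤ maximalIdeal A)
    {V' V'' : X.Opens} (hV' : IsAffineOpen V') (hV'' : IsAffineOpen V'') (l : V'' ≤ V')
    {W W' : Z.Opens} (hW : IsAffineOpen W) (hW' : IsAffineOpen W') (hWW' : W' ≤ W)
    {Wb Wb' : Zb.Opens} (hWb : Wb = pr ⁻¹ᵁ W) (hWb' : Wb' = pr ⁻¹ᵁ W') (hb : Wb' ≤ Wb)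
    (ψ₁ ψ₂ : Γ(X, V') →+* Γ(Z, W)) (ψ₁' ψ₂' : Γ(X, V'') →+* Γ(Z, W'))
    (hs₁ : ∀ x : A, ψ₁ (X.presheaf.map (homOfLE (le_top : V' ≤ ⊤)).op (specStructureMap p x)) =
      Z.presheaf.map (homOfLE (le_top : W ≤ ⊤)).op (specStructureMap q x))
    (hs₁' : ∀ x : A, ψ₁' (X.presheaf.map (homOfLE (le_top : V'' ≤ ⊤)).op (specStructureMap p x)) =
      Z.presheaf.map (homOfLE (le_top : W' ≤ ⊤)).op (specStructureMap q x))
    (hr₁ : ∀ a, ψ₁' (X.presheaf.map (homOfLE l).op a) = Z.presheaf.map (homOfLE hWW').op (ψ₁ a))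
    (hr₂ : ∀ a, ψ₂' (X.presheaf.map (homOfLE l).op a) = Z.presheaf.map (homOfLE hWW').op (ψ₂ a))
    (hδ₁₂ : ∀ a, ψ₂ a - ψ₁ a ∈ J.map ((Z.presheaf.map (homOfLE (le_top : W ≤ ⊤)).op).hom.comp (specStructureMap q)))
    {cm : Fin r → I → Γ(Zb, Wb)} {cm' : Fin r → I → Γ(Zb, Wb')}
    (h : ∀ (ψ₀ : Γ(X₀.left, G ⁻¹ᵁ V') →+* Γ(Zb, Wb)), (∀ a, ψ₀ (G.app V' a) = pr.appLE W Wb hWb.le (ψ₁ a)) →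
      ∀ (a : Γ(X, V')) (d : Fin r → Γ(Z, W)),
        ψ₂ a - ψ₁ a = ∑ ρ, Z.presheaf.map (homOfLE (le_top : W ≤ ⊤)).op (specStructureMap q (j ρ)) * d ρ →
        ∀ ρ, pr.appLE W Wb hWb.le (d ρ) =
          ∑ t, ψ₀ (coord e (homOfLE le_top) (dSection X₀ (G ⁻¹ᵁ V') (G.app V' a)) t) * cm ρ t)
    (h' : ∀ (ψ₀ : Γ(X₀.left, G ⁻¹ᵁ V'') →+* Γ(Zb, Wb')), (∀ a, ψ₀ (G.app V'' a) = pr.appLE W' Wb' hWb'.le (ψ₁' a)) →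
      ∀ (a : Γ(X, V'')) (d : Fin r → Γ(Z, W')),
        ψ₂' a - ψ₁' a = ∑ ρ, Z.presheaf.map (homOfLE (le_top : W' ≤ ⊤)).op (specStructureMap q (j ρ)) * d ρ →
        ∀ ρ, pr.appLE W' Wb' hWb'.le (d ρ) =
          ∑ t, ψ₀ (coord e (homOfLE le_top) (dSection X₀ (G ⁻¹ᵁ V'') (G.app V'' a)) t) * cm' ρ t) :
    cm' = fun ρ t => Zb.presheaf.map (homOfLE hb).op (cm ρ t) := by
  classical
  letI algZ : Algebra A Γ(Z, W) :=
    ((Z.presheaf.map (homOfLE (le_top : W ≤ ⊤)).op).hom.comp (specStructureMap q)).toAlgebra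
  obtain ⟨ψ₀, hψ₀⟩ := exists_reducedChart J hG hpr hJle hV' hW hWb ψ₁ hs₁
  obtain ⟨ψ₀', hψ₀'⟩ := exists_reducedChart J hG hpr hJle hV'' hW' hWb' ψ₁' hs₁'
  obtain ⟨hsurj, -⟩ := app_surjective_and_ker_eq_of_isPullback_mk J hG ⟨V', hV'⟩
  -- the two reduced charts are compatible with restriction
  have hGnat : ∀ a : Γ(X, V'), X₀.left.presheaf.map (homOfLE (G.preimage_mono l)).op (G.app V' a) =
      G.app V'' (X.presheaf.map (homOfLE l).op a) := fun a => by
    have h0 : X.presheaf.map (homOfLE l).op ≫ G.app V'' =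
        G.app V' ≫ X₀.left.presheaf.map (homOfLE (G.preimage_mono l)).op := G.naturality (homOfLE l).op
    have h1 := congrArg (fun φ => φ.hom a) h0
    simpa only [CommRingCat.hom_comp, RingHom.comp_apply] using h1.symm
  have hψ₀r : ∀ x : Γ(X₀.left, G ⁻¹ᵁ V'),
      ψ₀' (X₀.left.presheaf.map (homOfLE (G.preimage_mono l)).op x) = Zb.presheaf.map (homOfLE hb).op (ψ₀ x) := by
    intro x
    obtain ⟨a, rfl⟩ := hsurj x
    rw [hGnat, hψ₀', hr₁, appLE_map_apply_of_le (pr := pr) hWW' hWb hWb' hb, ← hψ₀]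
  -- CORE on `V″ ⊆ V'`
  refine matrix_ext_of_map J p hG e hV' l ψ₀' fun a ρ => ?_
  obtain ⟨d, hd⟩ := exists_eq_sum_mul_of_mem_map (C := Γ(Z, W)) j hspan (hδ₁₂ a)
  -- the restricted decomposition of the restricted difference
  have hd' : ψ₂' (X.presheaf.map (homOfLE l).op a) - ψ₁' (X.presheaf.map (homOfLE l).op a) =
      ∑ ρ, Z.presheaf.map (homOfLE (le_top : W' ≤ ⊤)).op (specStructureMap q (j ρ)) *
        Z.presheaf.map (homOfLE hWW').op (d ρ) := by
    rw [hr₁, hr₂, ← map_sub, hd, map_sum]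
    refine Finset.sum_congr rfl fun ρ _ => ?_
    rw [map_mul]
    congr 1
    change (Z.presheaf.map (homOfLE (le_top : W ≤ ⊤)).op ≫ Z.presheaf.map (homOfLE hWW').op) (specStructureMap q (j ρ)) = _
    rw [← Functor.map_comp]
    rfl
  have e' := h' ψ₀' hψ₀' (X.presheaf.map (homOfLE l).op a) (fun ρ => Z.presheaf.map (homOfLE hWW').op (d ρ)) hd' ρ
  have e₀ := h ψ₀ hψ₀ a d hd ρ
  -- compare: `pr♯'(d ρ|) = (pr♯ d ρ)|`
  rw [appLE_map_apply_of_le (pr := pr) hWW' hWb hWb' hb, e₀, map_sum] at e'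
  rw [← e']
  refine Finset.sum_congr rfl fun t _ => ?_
  rw [map_mul, ← hψ₀r, ← coord_dSection_map e (homOfLE le_top) (homOfLE (G.preimage_mono l)), hGnat]
  congr 2

end MatrixRestrict

end Literature.AlgebraicGeometry.Deformation

end
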